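import Literature.Barriers.RiemannHypothesis.DavenportHeilbronnDegreeTwo
import Literature.NumberTheory.EllipticCurves.HeckeOperatorsProofs
import Literature.NumberTheory.EllipticCurves.NewformsHeckeStableProofs
import Literature.NumberTheory.EllipticCurves.NewformsFiniteProofs
import Literature.NumberTheory.EllipticCurves.ModularCurveProofs
import HarnessLib

/-!
# Booker–Thorne at level one, step A: level-one cusp forms and the tree's Hecke theory

Sibling of `DavenportHeilbronnDegreeTwo.lean` (barrier catalogue, D-0021); everything here is
PROVED, there are no definitions and no named facts. This is the first step of the proof of
`Literature.Barriers.RiemannHypothesis.BookerThorne2014_levelOne_zeros` (Booker–Thorne 2014,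
Thm. 1 with §1 Remark 2, level `N = 1`) along the printed architecture (§4 of the paper: "`f`
is a linear combination of Hecke eigenforms `f = ∑ c_j f_j`, `P = ∑ c_j x_j`; `P` is a monomial iff
`f` is an eigenfunction of all `T_p`"):

* `coe_mcast_gamma0_one`, `qExpansion_mcast_gamma0_one` —
  `Γ₀(1) = SL(2, ℤ)` (tree: `gamma0_one_eq_top`, `coe_gamma0_one` of `ModularCurveProofs`), so a
  level-one cusp form `f : CuspForm 𝒮ℒ k` is `CuspForm.mcast rfl f coe_gamma0_one :
  CuspForm (Gamma0 1) k` with the same underlying function (hence the same `q`-expansion and the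
  same `Λ_f = cuspFormLambda f`, all by `rfl`);
* `isLevelOneHeckeEigenAt_iff_exists_heckeT_eq_smul` — the barrier file's coefficient-wise
  rendering `IsLevelOneHeckeEigenAt k (a_n(f)) p` of "`T_p f = λ f`" IS the eigenvector condition
  for the tree's Hecke operator `heckeT (Gamma0 1) k p` (Diamond–Shurman Prop. 5.2.2 / (5.4), via
  the tree's proved `qExpansion_coeff_heckeT_holds` and the `q`-expansion principle);
* `newSubspace0_one_eq_top`, `exists_sum_newforms0_eq` — at level one every cusp form is new and
  is a (finite) linear combination of the newforms (= normalised Hecke eigenforms), by the tree's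
  proved Atkin–Lehner theory (`span_newforms0_holds`, `finite_newforms0_holds`);
* `two_le_card_of_not_isLevelOneHeckeEigenAt` — if `f` fails to be a `T_p`-eigenfunction for one
  prime `p`, at least two newforms occur in `f` with non-zero coefficient (the polynomial
  `P = ∑ c_g x_g` of Booker–Thorne's Theorem 2 is not a monomial).

## References

* [BookerThorne2014] A. R. Booker, F. Thorne, *Zeros of L-functions outside the critical strip*,
  Algebra Number Theory 8 (2014), 2027–2042, Thm. 1, §4 (first step of the proof of Thm. 2).
* [DiamondShurman2005] F. Diamond, J. Shurman, *A First Course in Modular Forms*, Prop. 5.2.2,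
  (5.4), Def. 5.8.1, Thm. 5.8.2–5.8.3.
-/

noncomputable section

open UpperHalfPlane CongruenceSubgroup
open scoped MatrixGroups ModularForm
open Literature.NumberTheory.EllipticCurves.ModularForms

namespace Literature.Barriers.RiemannHypothesis

/-! ### Level one as `Γ₀(1)` (tree: `gamma0_one_eq_top`, `coe_gamma0_one`) -/

/-- A level-one cusp form transported to level `Γ₀(1)` keeps its underlying function. [folklore] -/
@[simp] theorem coe_mcast_gamma0_one {k : ℤ} (f : CuspForm 𝒮ℒ k) :
    ⇑(CuspForm.mcast rfl f coe_gamma0_one : CuspForm (Gamma0 1) k) = ⇑f := rfl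

/-- … hence keeps its `q`-expansion (and likewise, unfolding `cuspFormLambda`, its complete
`L`-function `Λ_f(s) = ∫_0^∞ f(iy) y^{s-1} dy` — again `rfl`, so no separate lemma). [folklore] -/
theorem qExpansion_mcast_gamma0_one {k : ℤ} (f : CuspForm 𝒮ℒ k) :
    qExpansion 1 ⇑(CuspForm.mcast rfl f coe_gamma0_one : CuspForm (Gamma0 1) k) =
      qExpansion 1 ⇑f := rfl

/-! ### `IsLevelOneHeckeEigenAt` is the eigenvector condition for `T_p` on `S_k(Γ₀(1))` -/

/-- If `T_p f = a • f` on `S_k(Γ₀(1))` then the Fourier coefficients of `f` satisfy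
`a(pn) + p^{k-1} a(n/p) = a · a(n)` (Diamond–Shurman (5.4) at `N = 1`), i.e.
`IsLevelOneHeckeEigenAt`. [cite: DiamondShurman2005, Prop. 5.2.2 and (5.4)] -/
theorem isLevelOneHeckeEigenAt_of_heckeT_eq_smul {k : ℤ} {f : CuspForm (Gamma0 1) k} {p : ℕ}
    [NeZero p] (hp : p.Prime) {a : ℂ} (h : heckeT (Gamma0 1) k p f = a • f) :
    IsLevelOneHeckeEigenAt k (fun n ↦ (qExpansion 1 ⇑f).coeff n) p := by
  refine ⟨a, fun n ↦ ?_⟩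
  have hn := qExpansion_coeff_heckeT_holds 1 k f p hp n
  rw [h, qExpansion_coeff_smul, if_neg hp.not_dvd_one] at hn
  simpa only [mul_ite, mul_zero] using hn.symm

/-- Conversely the coefficient relations force `T_p f = l • f`, by the `q`-expansion principle.
[cite: DiamondShurman2005, Prop. 5.2.2 and (5.4)] -/
theorem heckeT_eq_smul_of_isLevelOneHeckeEigenAt {k : ℤ} {f : CuspForm (Gamma0 1) k} {p : ℕ}
    [NeZero p] (hp : p.Prime) {l : ℂ}
    (h : ∀ n : ℕ, (qExpansion 1 ⇑f).coeff (p * n) +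
      (p : ℂ) ^ (k - 1) * (if p ∣ n then (qExpansion 1 ⇑f).coeff (n / p) else 0) =
        l * (qExpansion 1 ⇑f).coeff n) :
    heckeT (Gamma0 1) k p f = l • f := by
  refine eq_of_forall_cuspCoeff_eq_gamma0 fun n ↦ ?_
  change (qExpansion 1 ⇑(heckeT (Gamma0 1) k p f)).coeff n = (qExpansion 1 ⇑(l • f)).coeff n
  rw [qExpansion_coeff_heckeT_holds 1 k f p hp n, if_neg hp.not_dvd_one, qExpansion_coeff_smul,
    ← h n]

/-- **`IsLevelOneHeckeEigenAt k (a_n(f)) p ↔ f` is a `T_p`-eigenvector on `S_k(Γ₀(1))`.**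
[cite: DiamondShurman2005, Prop. 5.2.2 and (5.4)] -/
theorem isLevelOneHeckeEigenAt_iff_exists_heckeT_eq_smul {k : ℤ} (f : CuspForm (Gamma0 1) k)
    {p : ℕ} [NeZero p] (hp : p.Prime) :
    IsLevelOneHeckeEigenAt k (fun n ↦ (qExpansion 1 ⇑f).coeff n) p ↔
      ∃ a : ℂ, heckeT (Gamma0 1) k p f = a • f :=
  ⟨fun ⟨l, hl⟩ ↦ ⟨l, heckeT_eq_smul_of_isLevelOneHeckeEigenAt hp hl⟩,
    fun ⟨_, ha⟩ ↦ isLevelOneHeckeEigenAt_of_heckeT_eq_smul hp ha⟩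

/-! ### At level one every cusp form is a combination of newforms -/

/-- There are no degeneracy data at level `1` (no proper divisors). [folklore] -/
theorem isEmpty_degeneracyIndex_one : IsEmpty (DegeneracyIndex 1) :=
  ⟨fun x ↦ by simpa using x.2.1⟩

/-- At level one the new subspace is everything: `S_k(Γ₀(1))^{new} = S_k(Γ₀(1))` (there are no
lower levels). [folklore] -/
theorem newSubspace0_one_eq_top (k : ℤ) : newSubspace0 1 k = ⊤ := by
  haveI := isEmpty_degeneracyIndex_one
  exact eq_top_iff.2 (le_iInf fun i ↦ (IsEmpty.false i).elim)

/-- **Every level-one cusp form is a linear combination of the (finitely many) newforms of level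
one** — the normalised Hecke eigenforms (Atkin–Lehner; Diamond–Shurman Thm. 5.8.2–5.8.3: the
newforms form a basis of the new subspace, which at level one is the whole space).
[cite: DiamondShurman2005, Thm. 5.8.3] -/
theorem exists_sum_newforms0_eq {k : ℤ} (f : CuspForm (Gamma0 1) k) :
    ∃ c : CuspForm (Gamma0 1) k → ℂ, Function.support c ⊆ newforms0 1 k ∧
      ∑ g ∈ (finite_newforms0_holds 1 k).toFinset, c g • g = f := by
  have hf : f ∈ Submodule.span ℂ (newforms0 1 k) := by
    rw [span_newforms0_holds 1 k, newSubspace0_one_eq_top]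
    exact Submodule.mem_top
  rw [← coe_toFinset_newforms0 1 k, Submodule.mem_span_finset] at hf
  obtain ⟨c, hc, hsum⟩ := hf
  exact ⟨c, by simpa only [coe_toFinset_newforms0] using hc, hsum⟩

/-- A combination of newforms in which at most one newform `g₀` carries a non-zero coefficient
is a `T_p`-eigenvector for every prime `p` (it is `c • g₀`, and newforms are Hecke eigenforms).
[cite: DiamondShurman2005, Def. 5.8.1] -/
theorem exists_heckeT_eq_smul_of_support_subsingleton {k : ℤ} {s : Finset (CuspForm (Gamma0 1) k)}
    (hs : ↑s ⊆ newforms0 1 k) {c : CuspForm (Gamma0 1) k → ℂ}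
    (hc : ∀ g ∈ s, ∀ g' ∈ s, c g ≠ 0 → c g' ≠ 0 → g = g') {p : ℕ} [NeZero p] (hp : p.Prime) :
    ∃ a : ℂ, heckeT (Gamma0 1) k p (∑ g ∈ s, c g • g) = a • ∑ g ∈ s, c g • g := by
  classical
  by_cases h0 : ∀ g ∈ s, c g = 0
  · refine ⟨0, ?_⟩
    have : ∑ g ∈ s, c g • g = 0 := Finset.sum_eq_zero fun g hg ↦ by simp [h0 g hg]
    simp [this]
  · push Not at h0
    obtain ⟨g₀, hg₀, hcg₀⟩ := h0
    have hsum : ∑ g ∈ s, c g • g = c g₀ • g₀ := by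
      refine Finset.sum_eq_single_of_mem g₀ hg₀ fun g hg hne ↦ ?_
      have : c g = 0 := by
        by_contra hcg
        exact hne (hc g hg g₀ hg₀ hcg hcg₀)
      simp [this]
    have hnew : IsNewform0 g₀ := hs hg₀
    refine ⟨(qExpansion 1 ⇑g₀).coeff p, ?_⟩
    rw [hsum, map_smul, hnew.heckeT_eq_coeff_smul hp, smul_comm]

/-- **Not a monomial.** If a level-one cusp form `f = ∑_g c_g g` (sum over the newforms `g` of
level one) is NOT a `T_p`-eigenvector for some prime `p`, then at least two distinct newforms
carry non-zero coefficients — the linear polynomial `P = ∑ c_g x_g` of Booker–Thorne's Theorem 2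
is not a monomial. [cite: BookerThorne2014, §4 (reduction of Thm. 1 to Thm. 2)] -/
theorem exists_two_ne_zero_of_not_exists_heckeT_eq_smul {k : ℤ}
    {s : Finset (CuspForm (Gamma0 1) k)} (hs : ↑s ⊆ newforms0 1 k)
    {c : CuspForm (Gamma0 1) k → ℂ} {p : ℕ} [NeZero p] (hp : p.Prime)
    (h : ¬ ∃ a : ℂ, heckeT (Gamma0 1) k p (∑ g ∈ s, c g • g) = a • ∑ g ∈ s, c g • g) :
    ∃ g ∈ s, ∃ g' ∈ s, g ≠ g' ∧ c g ≠ 0 ∧ c g' ≠ 0 := by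
  by_contra hcon
  push Not at hcon
  exact h (exists_heckeT_eq_smul_of_support_subsingleton hs
    (fun g hg g' hg' hcg hcg' ↦ by
      by_contra hne
      exact hcg' (hcon g hg g' hg' hne hcg)) hp)

/-- **Step A of the proof of `BookerThorne2014_levelOne_zeros`, assembled.** A level-one cusp
form `f : CuspForm 𝒮ℒ k` which is not a `T_p`-eigenfunction for some prime `p` (in the sense of
`IsLevelOneHeckeEigenAt` on its `q`-expansion) is a finite linear combination `f = ∑_{g ∈ s} c_g g`
of level-one newforms (normalised Hecke eigenforms, `s` = all newforms of level one and weight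
`k`) in which at least two distinct newforms have non-zero coefficients; the combination has the
same underlying function as `f`. [cite: BookerThorne2014, §4 (reduction of Thm. 1 to Thm. 2)] -/
theorem exists_newform_combination_of_not_isLevelOneHeckeEigenAt {k : ℤ} (f : CuspForm 𝒮ℒ k)
    {p : ℕ} (hp : p.Prime)
    (hf : ¬ IsLevelOneHeckeEigenAt k (fun n ↦ (qExpansion 1 f).coeff n) p) :
    ∃ (s : Finset (CuspForm (Gamma0 1) k)) (c : CuspForm (Gamma0 1) k → ℂ),
      ↑s = newforms0 1 k ∧
      (⇑(∑ g ∈ s, c g • g) : ℍ → ℂ) = ⇑f ∧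
      ∃ g ∈ s, ∃ g' ∈ s, g ≠ g' ∧ c g ≠ 0 ∧ c g' ≠ 0 := by
  haveI : NeZero p := ⟨hp.ne_zero⟩
  set f₀ : CuspForm (Gamma0 1) k := CuspForm.mcast rfl f coe_gamma0_one with hf₀
  obtain ⟨c, -, hsum⟩ := exists_sum_newforms0_eq f₀
  refine ⟨(finite_newforms0_holds 1 k).toFinset, c, coe_toFinset_newforms0 1 k, ?_, ?_⟩
  · rw [hsum]
    rfl
  · refine exists_two_ne_zero_of_not_exists_heckeT_eq_smul
      (by rw [coe_toFinset_newforms0]) hp ?_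
    rw [hsum, ← isLevelOneHeckeEigenAt_iff_exists_heckeT_eq_smul f₀ hp]
    exact hf

end Literature.Barriers.RiemannHypothesis
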